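import Summits.QuantumFields.YangMills.Theorems.UnitScaleTiltProp7QH1SuRowOfRLegs
import Summits.QuantumFields.YangMills.Theorems.UnitScaleTiltProp7RLegsCovKnitB
import HarnessLib

/-!
# Route `UnitScaleTilt`, crux K1 «MinimiserStabilityRegPr» (stmt-QuantumFields-19200), LANE II, row (QH1)♮ — corollary of ✓`Prop7QH1SuRowOfRLegs.h𝔰𝔲_doorH_of_rlegs`:
# **`h𝔰𝔲` AT THE DOOR'S `H` FROM THE TWO `ℓ⁻²`-ANCHORED LINEAR-RESPONSE ROWS (hG♭) ∧ (hN♭) OF THE COMB TOWER** (★w4-20520 g13's K2′ ✓`Prop7RLegsCovKnitB.rlegs_of_linTower_rowsB`)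

Cell `ym3-torus`, width seat `ym3-torus-px21` (gen 8; w4-20520 g13 13:14:25Z pointer «consume `rlegs_of_linTower_rowsB` (K2′), not v1»).  THEOREMS ONLY (0 `def`, 0 `sorry`);
`--supports stmt-QuantumFields-19200 --as helper`, count-neutral.  YM₃ on T³ is a ladder rung (R3), not d = 4, not infinite volume, not the Clay problem; nothing here claims the
stub, the crux, `hN06`, (QH1), (QB) or the mass gap.  CONDITIONAL: the two anchored rows `hG`, `hN` (★routeR's F-9d pens) are DISPLAYED, not proved.

WHAT IS PROVED (ns `…Theorems.Prop7QH1SuRowOfLinTowerRows`): ★★ `h𝔰𝔲_doorH_of_linTower_rowsB (c₀ cB) (hG) (hN)` — ✓`h𝔰𝔲_doorH_of_rlegs c₀ cB (rlegs_of_linTower_rowsB hG hN)`;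
binders `hG`∕`hN` = K2′'s VERBATIM, conclusion = ✓`h𝔰𝔲_doorH_of_rlegs`'s VERBATIM.  A one-line composition; nothing else.

References: T. Bałaban, CMP **98** (1985) 17–51 [Balaban1985Averaging] ((110)–(112) p.34, (160)–(163) p.42); CMP **99** (1985) 389–434 [Balaban1985BackgroundPropagators]
((3.11) p.392, (3.41)–(3.44) pp.397–398); CMP **102** (1985) 277–309 [Balaban1985Variational] ((44) p.285).
-/

set_option autoImplicit false

noncomputable section

open scoped BigOperators Matrix.Norms.L2Operator Matrix InnerProductSpace ComplexConjugate

namespace Summit.QuantumFields.YangMills.Theorems.Prop7QH1SuRowOfLinTowerRows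

open Literature.MathematicalPhysics.QuantumFieldTheory.Balaban1983to89
open Literature.MathematicalPhysics.QuantumFieldTheory.Balaban1983to89.T3ContinuumYM3Torus
open Literature.MathematicalPhysics.QuantumFieldTheory.Balaban1983to89.T3PrintedRegularMinimiser (RegPr)
open T4Continuum BlockAveraging AveragingRT ExpMeanLog
open T3LevelShift (bondShift)
open T3PrintedRegularOrbits (sites_eq)
open T3SectALandauChart (bgUnits)
open B7Prop1Explicit (e expUnit)
open B7Prop2Explicit (avgIter)
open B7Eq92Concrete (tildIter)
open B7Eq78Linearization (conjR)
open B10Eq27TorusAxialLog (pull unitsField toUField)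
open B9Eq39Adjoint (curl divB)
open B9TorusCalculus (torusT)
open B11Eq103H1Complex (BondL2K)
open Summit.QuantumFields.YangMills.Theorems.Prop7SPrint (basePt)
open Summit.QuantumFields.YangMills.Theorems.Prop7SectET3Transport (periodsT3)
open Summit.QuantumFields.YangMills.Theorems.Prop7SectET3HilbertLetters (W₂ toL2 DstarL2)
open Summit.QuantumFields.YangMills.Theorems.Prop7SectET3CombLetters (Qkc)
open Summit.QuantumFields.YangMills.Theorems.Prop7SymAvgTw (frameTw)
open Summit.QuantumFields.YangMills.Theorems.Prop7QH1SuRowOfRLegs (h𝔰𝔲_doorH_of_rlegs)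
open Summit.QuantumFields.YangMills.Theorems.Prop7RLegsCovKnitB (rlegs_of_linTower_rowsB)

variable (c₀ cB : ℕ → ℝ) [hc₀ : ∀ L : ℕ, Fact (0 < c₀ L)] [hcB : ∀ L : ℕ, Fact (0 < cB L)]

/-- ★★ **(QH1)♮-𝔰𝔲 FROM (hG♭) ∧ (hN♭)**: ✓`h𝔰𝔲_doorH_of_rlegs` ∘ ★w4-20520's ✓`rlegs_of_linTower_rowsB`.  DISPLAYED: `hG`, `hN` (K2′'s binders VERBATIM).
[cite: Balaban1985Averaging, (110)–(112) p.34, (160)–(163) p.42; Balaban1985BackgroundPropagators, (3.11) p.392, (3.41)–(3.44) pp.397–398] -/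
theorem h𝔰𝔲_doorH_of_linTower_rowsB
    (hG : ∀ (L : ℕ), 1 < L → ∃ CG CG' eG : ℝ, 0 ≤ CG ∧ 0 ≤ CG' ∧ 0 < eG ∧
      ∀ (F : T3Family), F.L = L → ∀ (n K : ℕ) (hnK : n < K) (e : ℝ) (W : GaugeField (F.P K) 0 (Matrix.specialUnitaryGroup (Fin 2) ℂ)),
        0 < e → e ≤ eG → RegPr F n K e W → ∀ (A : PBond (F.P K) 0 → Matrix (Fin 2) (Fin 2) ℂ) (l : ℕ), l < K - n → ∀ μ : Fin (F.P K).d,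
        ∑ x : Site (F.P K) l, ∑ κ : Fin (F.P K).d,
          ‖fderiv ℂ (fun t : PBond (F.P K) 0 → Matrix (Fin 2) (Fin 2) ℂ =>
                ((tildIter (F.P K).L (pull (bgUnits F K W) (basePt F n K)) (pull (fun b => expUnit (t b)) (basePt F n K)) l (fun ν => ((x ν).val : ℤ)) κ :
                  (Matrix (Fin 2) (Fin 2) ℂ)ˣ) : Matrix (Fin 2) (Fin 2) ℂ)) 0 A
            - conjR (avgIter (F.P K).L (pull (bgUnits F K W) (basePt F n K)) l (fun ν => ((x ν).val : ℤ)) μ)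
              (fderiv ℂ (fun t : PBond (F.P K) 0 → Matrix (Fin 2) (Fin 2) ℂ =>
                ((tildIter (F.P K).L (pull (bgUnits F K W) (basePt F n K)) (pull (fun b => expUnit (t b)) (basePt F n K)) l ((fun ν => ((x ν).val : ℤ)) + B7Prop1Explicit.e μ) κ :
                  (Matrix (Fin 2) (Fin 2) ℂ)ˣ) : Matrix (Fin 2) (Fin 2) ℂ)) 0 A)‖ ^ 2
          ≤ CG * (F.L : ℝ) ^ l * (∑ b : PBond (F.P K) 0, ∑ ν : Fin (F.P K).d,
                ‖((W ⟨b.src, ν⟩ : Matrix.specialUnitaryGroup (Fin 2) ℂ) : Matrix (Fin 2) (Fin 2) ℂ) * A ⟨b.src.shift ν, b.dir⟩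
                    * star ((W ⟨b.src, ν⟩ : Matrix.specialUnitaryGroup (Fin 2) ℂ) : Matrix (Fin 2) (Fin 2) ℂ) - A b‖ ^ 2)
            + CG' * e ^ 2 * (F.L : ℝ) ^ l * (((F.L : ℝ) ^ (K - n)) ^ 2)⁻¹ * ∑ b : PBond (F.P K) 0, ‖A b‖ ^ 2)
    (hN : ∀ (L : ℕ), 1 < L → ∃ CN CN' CN'' eN : ℝ, 0 ≤ CN ∧ 0 ≤ CN' ∧ 0 ≤ CN'' ∧ 0 < eN ∧
      ∀ (F : T3Family), F.L = L → ∀ (n K : ℕ) (hnK : n < K) (e : ℝ) (W : GaugeField (F.P K) 0 (Matrix.specialUnitaryGroup (Fin 2) ℂ)),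
        0 < e → e ≤ eN → RegPr F n K e W → ∀ (A : PBond (F.P K) 0 → Matrix (Fin 2) (Fin 2) ℂ) (l : ℕ), l < K - n →
        ∑ x : Site (F.P K) l, ∑ κ : Fin (F.P K).d,
          ‖fderiv ℂ (fun t : PBond (F.P K) 0 → Matrix (Fin 2) (Fin 2) ℂ =>
                ((tildIter (F.P K).L (pull (bgUnits F K W) (basePt F n K)) (pull (fun b => expUnit (t b)) (basePt F n K)) l (fun ν => ((x ν).val : ℤ)) κ :
                  (Matrix (Fin 2) (Fin 2) ℂ)ˣ) : Matrix (Fin 2) (Fin 2) ℂ)) 0 A‖ ^ 2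
          ≤ CN * ((F.L : ℝ) ^ l)⁻¹ * ∑ b : PBond (F.P K) 0, ‖A b‖ ^ 2
            + CN' * (F.L : ℝ) ^ l * (∑ b : PBond (F.P K) 0, ∑ ν : Fin (F.P K).d,
                ‖((W ⟨b.src, ν⟩ : Matrix.specialUnitaryGroup (Fin 2) ℂ) : Matrix (Fin 2) (Fin 2) ℂ) * A ⟨b.src.shift ν, b.dir⟩
                    * star ((W ⟨b.src, ν⟩ : Matrix.specialUnitaryGroup (Fin 2) ℂ) : Matrix (Fin 2) (Fin 2) ℂ) - A b‖ ^ 2)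
            + CN'' * e ^ 2 * (F.L : ℝ) ^ l * (((F.L : ℝ) ^ (K - n)) ^ 2)⁻¹ * ∑ b : PBond (F.P K) 0, ‖A b‖ ^ 2) :
    ∀ (L : ℕ), 1 < L → ∃ B B' B'' eQ : ℝ, 0 ≤ B ∧ 0 ≤ B' ∧ 0 ≤ B'' ∧ 0 < eQ ∧
      ∀ (F : T3Family), F.L = L → ∀ (n K : ℕ) (hnK : n < K) (e : ℝ) (W : GaugeField (F.P K) 0 (Matrix.specialUnitaryGroup (Fin 2) ℂ)),
        0 < e → e ≤ eQ → RegPr F n K e W →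
        ∀ A : PBond (F.P K) 0 → Matrix (Fin 2) (Fin 2) ℂ, (∀ b, A b ∈ skewAdjoint (Matrix (Fin 2) (Fin 2) ℂ)) → (∀ b, (A b).trace = 0) →
          (c₀ F.L / cB F.L) * ((F.L : ℝ) ^ (K - n)) ^ 3 * ‖Qkc F n K hnK.le (c₀ F.L) (cB F.L) W (toL2 F K (c₀ F.L) A)‖ ^ 2
            ≤ B * ‖toL2 F K (c₀ F.L) A‖ ^ 2
              + B' * (fun (F : T3Family) (n K : ℕ) (W : GaugeField (F.P K) 0 (Matrix.specialUnitaryGroup (Fin 2) ℂ)) (f : BondL2K ℂ 3 (periodsT3 F K) (c₀ F.L) W₂) =>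
                c₀ F.L * ((F.L : ℝ) ^ (K - n)) ^ 2 * (∑ x : Site (F.P K) 0, ∑ μ : Fin (F.P K).d, ∑ ν : Fin (F.P K).d,
                    (if μ < ν then ∑ j : Fin 2, ∑ k : Fin 2,
                      ‖(curl (torusT (F.P K) 0) (fun κ z => unitsField (toUField W) ⟨z, κ⟩) (fun κ z => (toL2 F K (c₀ F.L)).symm f ⟨z, κ⟩) μ ν x) j k‖ ^ 2 else 0))
                  + ‖DstarL2 F n K (c₀ F.L) W f‖ ^ 2) F n K W (toL2 F K (c₀ F.L) A)
              + B'' * e * ‖toL2 F K (c₀ F.L) A‖ ^ 2 :=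
  h𝔰𝔲_doorH_of_rlegs c₀ cB (rlegs_of_linTower_rowsB hG hN)

end Summit.QuantumFields.YangMills.Theorems.Prop7QH1SuRowOfLinTowerRows

end
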